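import Summits.QuantumFields.YangMills.Theorems.BalabanLadderIRAbstractBasinRung
import HarnessLib

/-!
# The abstract purity basin has a CEILING at `1/2`: degenerate-vacua families (ideator ym-ir-idea-6 g2, lens FSS)

Answer (certified, model-free) to director-ym g9 №16 (4) «KEEP SHRINKING — can the abstract chain take the seed tolerance higher?»:
NOT to `1/2` or beyond.  For every `k ≥ 1` the four-index family

  `Z_k(a,b,c,d) = k · exp(−k · abcd)`   («`k` exactly degenerate vacua, nothing else»; the large-volume caricature of a
  first-order point / a `k`-fold broken discrete symmetry, e.g. the low-temperature Ising model for `k = 2`)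

is axis-symmetric, trace-positive in every slot (spectral datum: `k` equal eigenvalues `e^{−k·b₁b₂b₃}`, index type `Fin k`) and
has volume bounds (`A = k`), yet its cold defect is the SCALE-INVARIANT constant `boxDefect Z_k L = 1 − 1/k` at EVERY `L`.  Hence
`AbstractBasin θ ε` (line `basin-transfer`, ideator ym-ir-idea-9: «θ-purity at one scale ≥ 8 forces ε-purity at some scale ≥ 8»,
PROVED in the tree for `θ = 2⁻⁶`, `ε = 2⁻⁸ … 2⁻²⁴`) is FALSE as soon as `1 − 1/k ≤ θ` and `ε < 1 − 1/k` for some `k ≥ 2`; in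
particular `¬ AbstractBasin θ ε` for all `θ ≥ 1/2 > ε`.  The group-free ladder of seed tolerances therefore lives inside `[0, 1/2)`:
`2⁻⁶ ✓ (tree) … 1/8 ? (cscan) … < 1/2 ✗`.  (Remark, not formalised: inside the sub-class of finite exponential mixtures
`Z = Σⱼ wⱼ e^{−cⱼ·abcd}`, `wⱼ ∈ ℕ`, the only non-zero scale-invariant defects are exactly these `1 − 1/k`; a counterexample strictly
inside `(0, 1/2)` needs infinitely many genuinely shape-dependent levels.)

HONEST FRAMING.  Nothing here proves the Yang–Mills mass gap (Clay), a lattice gap, `BalabanLadder.IR` (stmt-QuantumFields-19354) or its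
seed; it is a NEGATIVE∕ceiling fact about the abstract (group-free) basin class of the proved bootstrap `defectSquaring`.  R4 closes only the
conditional finite-𝕋⁴ rung `BalabanLadder.UV`.
-/

noncomputable section

open Summit.QuantumFields.YangMills.Cruxes.IR.AspectBootstrap
open Summit.QuantumFields.YangMills.Cruxes.IR.BasinRung (AbstractBasin)

namespace Summit.QuantumFields.YangMills.Cruxes.IR.AspectBootstrap.Ceiling

/-- The `k`-degenerate-vacua family `Z_k(a,b,c,d) = k·e^{−k·abcd}`. -/
def degenerateFamily (k : ℕ) : ℕ → ℕ → ℕ → ℕ → ℝ :=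
  fun a b c d => (k : ℝ) * Real.exp (-((k : ℝ) * ((a * b * c * d : ℕ) : ℝ)))

/-- `Z_k` is axis-symmetric (it depends on `abcd` only). -/
theorem degenerateFamily_axisSymmetric (k : ℕ) : IsAxisSymmetric (degenerateFamily k) := by
  intro a b c d
  refine ⟨?_, ?_, ?_⟩ <;> simp only [degenerateFamily] <;> congr 4 <;> push_cast <;> ring

/-- `Z_k` is trace-positive in the last slot for every spatial box: `k` equal eigenvalues `e^{−k·b₁b₂b₃}` (index `Fin k`). -/
theorem degenerateFamily_tracePositive {k : ℕ} (hk : 1 ≤ k) : IsTracePositive (degenerateFamily k) := by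
  intro b₁ b₂ b₃ _ _ _
  refine ⟨Fin k, fun _ => Real.exp (-((k : ℝ) * ((b₁ * b₂ * b₃ : ℕ) : ℝ))), ⟨0, hk⟩,
    fun _ => ⟨(Real.exp_pos _).le, le_rfl⟩, Real.exp_pos _, fun m => ?_⟩
  have hsum := hasSum_fintype (fun _ : Fin k => Real.exp (-((k : ℝ) * ((b₁ * b₂ * b₃ : ℕ) : ℝ))) ^ (m + 2))
  simp only [Finset.sum_const, Finset.card_univ, Fintype.card_fin, nsmul_eq_mul] at hsum
  convert hsum using 1
  simp only [degenerateFamily]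
  rw [← Real.exp_nat_mul]
  congr 2
  push_cast
  ring

/-- `Z_k` has volume bounds with `A = k`: `e^{−k·abcd} ≤ k·e^{−k·abcd} ≤ 1` for sides `≥ 2`. -/
theorem degenerateFamily_volumeBounds {k : ℕ} (hk : 1 ≤ k) : HasVolumeBounds (degenerateFamily k) := by
  refine ⟨k, fun a b c d _ _ _ _ => ⟨?_, ?_⟩⟩
  · -- `e^{−k·V} ≤ k · e^{−k·V}`
    simp only [degenerateFamily]
    have hk1 : (1 : ℝ) ≤ k := by exact_mod_cast hk
    have hE := Real.exp_pos (-((k : ℝ) * ((a * b * c * d : ℕ) : ℝ)))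
    nlinarith
  · -- `k · e^{−k·V} ≤ 1` since `V ≥ 1` and `k ≤ e^{k} ≤ e^{kV}`
    simp only [degenerateFamily]
    have hV : (1 : ℝ) ≤ ((a * b * c * d : ℕ) : ℝ) := by
      have : 1 ≤ a * b * c * d := by
        have ha : 1 ≤ a := by omega
        have hb : 1 ≤ b := by omega
        have hc : 1 ≤ c := by omega
        have hd : 1 ≤ d := by omega
        calc 1 = 1 * 1 * 1 * 1 := by norm_num
          _ ≤ a * b * c * d := by gcongr
      exact_mod_cast this
    have hk0 : (0 : ℝ) ≤ k := by positivity
    have h1 : (k : ℝ) ≤ Real.exp ((k : ℝ) * ((a * b * c * d : ℕ) : ℝ)) := by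
      calc (k : ℝ) ≤ (k : ℝ) * ((a * b * c * d : ℕ) : ℝ) := by nlinarith
        _ ≤ (k : ℝ) * ((a * b * c * d : ℕ) : ℝ) + 1 := by linarith
        _ ≤ Real.exp ((k : ℝ) * ((a * b * c * d : ℕ) : ℝ)) := Real.add_one_le_exp _
    rw [Real.exp_neg]
    have hE := Real.exp_pos ((k : ℝ) * ((a * b * c * d : ℕ) : ℝ))
    rw [mul_inv_le_iff₀ hE, one_mul]
    exact h1

/-- The cold defect of `Z_k` is the constant `1 − 1/k` at every scale. -/
theorem boxDefect_degenerateFamily {k : ℕ} (hk : 1 ≤ k) (L : ℕ) :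
    boxDefect (degenerateFamily k) L = 1 - 1 / k := by
  have hk0 : (k : ℝ) ≠ 0 := by exact_mod_cast (show k ≠ 0 by omega)
  simp only [boxDefect, degenerateFamily]
  have hcast : ((L * L * L * (2 * (L / 4)) : ℕ) : ℝ) = 2 * ((L * L * L * (L / 4) : ℕ) : ℝ) := by
    push_cast; ring
  rw [hcast]
  set V : ℝ := ((L * L * L * (L / 4) : ℕ) : ℝ) with hV
  have hsq : Real.exp (-((k : ℝ) * (2 * V))) = Real.exp (-((k : ℝ) * V)) ^ 2 := by
    rw [sq, ← Real.exp_add]; congr 1; ring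
  rw [hsq]
  have hE : Real.exp (-((k : ℝ) * V)) ≠ 0 := (Real.exp_pos _).ne'
  field_simp

/-- **CEILING**: `AbstractBasin θ ε` fails whenever a degenerate-vacua constant `1 − 1/k` (`k ≥ 1`) lies in `[?, θ]` above `ε`. -/
theorem not_abstractBasin_of_degenerate {θ ε : ℝ} {k : ℕ} (hk : 1 ≤ k) (hθ : 1 - 1 / (k : ℝ) ≤ θ)
    (hε : ε < 1 - 1 / (k : ℝ)) : ¬ AbstractBasin θ ε := by
  intro h
  obtain ⟨L', -, hL'⟩ := h (degenerateFamily k) (degenerateFamily_axisSymmetric k) (degenerateFamily_tracePositive hk)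
    (degenerateFamily_volumeBounds hk) 8 le_rfl (by rw [boxDefect_degenerateFamily hk]; exact hθ)
  rw [boxDefect_degenerateFamily hk] at hL'
  linarith

/-- **The abstract seed ladder stops below `1/2`**: for every `θ ≥ 1/2` and `ε < 1/2`, `¬ AbstractBasin θ ε` (two degenerate vacua). -/
theorem not_abstractBasin_half {θ ε : ℝ} (hθ : 1 / 2 ≤ θ) (hε : ε < 1 / 2) : ¬ AbstractBasin θ ε :=
  not_abstractBasin_of_degenerate (k := 2) (by norm_num) (by norm_num; linarith) (by norm_num; linarith)

/-- In particular the tree's target tolerance `ε = 2⁻⁶` cannot be reached from any seed tolerance `θ ≥ 1/2`. -/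
theorem not_abstractBasin_half_two_pow_6 {θ : ℝ} (hθ : 1 / 2 ≤ θ) : ¬ AbstractBasin θ (1 / 2 ^ 6) :=
  not_abstractBasin_half hθ (by norm_num)

end Summit.QuantumFields.YangMills.Cruxes.IR.AspectBootstrap.Ceiling

end
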